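import Literature.MathematicalPhysics.QuantumFieldTheory.Dimock2011to13.QED3SingularWalkBound
import Literature.MathematicalPhysics.QuantumFieldTheory.Dimock2011to13.QED3OnePointBlockSum
import HarnessLib

/-!
# Dimock, *QED on the 3-torus. II*, §3.2 THEOREM 1 (134), single-scale member (Remark 3) WITH THE LATTICE GEOMETRY
# CONCRETE: the path bound `|S_{k,Λ,ω}(A,x,y)| ≤ O(1)(O(1)M_0^{−1})^{|ω|}d′(x,y)^{−2}e^{−O(1)d_Λ(x,y)}` of the tree's
# `dimock134` with its distance `d`, block radius `r` and one-point sum `K` no longer hypotheses but the tree's `pathDist`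
# (127), `w′·h` and `(2∕(1 − e^{−cw′s∕2|ι|}))^{|ι|}` ((155), `one_point_sum_pathDist_const_le`)

statement-level skeleton of published theorems with citation tags; proofs where landed; nothing here is a claim about the Yang–Mills mass gap

**Citation header (reproduction of PUBLISHED work).** J. Dimock, *Quantum electrodynamics on the 3-torus. II*,
arXiv:math-ph/0407063 [Dimock2004QED3TorusII], **§3.2 THEOREM 1** (132)–(134) p.22 L2–19, Remark 3 p.22 L28–30, proof
Part III (152)–(155) p.24 L59 – p.25 L12; **§3.1** (127) p.21 L16–23; of the held arXiv text layer
`paper:arxiv-math-ph_0407063` (`p.NN Lnn` = PDF page ∕ text-layer line).  Writer seat p11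
(literature-prover-lit-balaban-p11-g23-0), YM LIT SWEEP item (c) D13 (row C13 «WHERE»; zero weight for the YM-INPRINT
tokens).  Imports the tree's `QED3SingularWalkBound` (`dimock134`: the engine with abstract `d`, `r`, `K`) and
`QED3OnePointBlockSum` (`one_point_sum_pathDist_const_le`; via it `QED3ScaledPathMetric`: `pathDist`, `pathDist_const`).

**The printed text.** THEOREM 1 p.22 L12–19: *"… We have the bound for each path
`|S_{k,Λ,ω}(A,x,y)| ≤ O(1)(O(1)M_0^{−1})^{|ω|}d′(x,y)^{−2}exp(−O(1)d_Λ(x,y))` (134)"*; Remark 3 p.22 L28–30: *"It is possible that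
`Λ` is a sequence of the full tori … In this case `d_Λ(x,y) = d(x,y)`"*; p.24 L59–62: *"we can also partition `L^{−k}Λ_0` into
smaller blocks `Δ` of size `L^{−(k−i)}` in `δΛ^{(k)}_i`"*; (155) p.25 L2–10 (the chain of exponentials, *"see [7], lemma 2.1"*).

**What is formalized (kernel-checked, zero `sorry`).**  `dimock134_lattice`: the tree's `dimock134` (sites `X`, blocks =
fibres of `blk : X → B` with centres `ctr`, weights `w ≥ 0`, singular weight `P ≥ 0` with the block convolution bound (154)
of constant `θ`, link kernels `Ks` with the printed bounds (137) ∕ (143)) in which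
* the distance is `d(u,v) = pathDist (fun _ ↦ w′) (e u) (e v)` — the tree's (127) with ONE weight `w′ > 0` (Remark 3),
  for any index map `e : X → ℤ^ι` of the sites; `hd0`, `hsymm`, `htri` of `dimock134` are DISCHARGED by `pathDist_nonneg`,
  `pathDist_comm`, `pathDist_triangle`;
* the block centres sit on a lattice, `e (ctr b) = u₀ + s·idx b` (`idx : B → ℤ^ι` injective, `s ≥ 1` the block side in
  lattice units), and every site is within sup-distance `h` of its block's centre: `hrad` is DISCHARGED with `r = w′·h`
  (`pathDist_const`), and the one-point sum `hK` with `K = (2∕(1 − e^{−(c∕2)w′s∕|ι|}))^{|ι|}` (`one_point_sum_pathDist_const_le`,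
  the single-scale (155));
* conclusion: `‖pathKernel w Ks n x y‖ ≤ C₀e^{3cw′h}(C₁θKe^{2cw′h}∕M_0)^n·P(x,y)·e^{−(c∕2)d(x,y)}` — (134) with every `O(1)`
  an explicit function of `ι, c, w′, s, h, θ, C₀, C₁`, uniform in the volume (`|X|`, `|B|`).
What REMAINS hypothesis is exactly the printed analytic input: the kernel bounds (137) ∕ (143) (`hK0`, `hKS`; LEMMA 2 and
Part II) and (154) (`hconv`; on `ℤ³` with `P = d′^{−2}` it is the tree's `QED3SingularWalkBound.hconv_Z3`, LEMMA 1 (130)).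

**Honest scope.** Single scale only (the multiscale (134) is the tree's `QED3BackgroundFieldSeries.dimock134_multiscale`
with `d_Λ`, `K` abstract; its `K` needs Bałaban's Lemma 2.1).  The lattice conventions are those of
`QED3ScaledPathMetric` (king walks, sup norm); for the blocks `Δ` of p.24 L59–62 on `T^{−k}`: `s = L^i` lattice units,
`w′ = L^{−k}·L^{k−i}`, `w′s = 1`, `h ≤ s` so `r ≤ 1`.  No named facts are introduced.
-/

namespace Literature.MathematicalPhysics.QuantumFieldTheory.Dimock2011to13

namespace QED3TorusII

open Finset Real QED3PathMetric

variable {ι : Type*} [Fintype ι] [DecidableEq ι]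
variable {X B : Type*} [Fintype X] [Fintype B] [DecidableEq B]
variable {E : Type*} [NormedRing E] [NormedAlgebra ℝ E]

/-- **THEOREM 1 (134), single-scale member, lattice geometry concrete.**  With `d(u,v) = pathDist (fun _ ↦ w′) (e u) (e v)`
(`w′ > 0`), block centres `e (ctr b) = u₀ + s·idx b` (`idx` injective, `1 ≤ s`), every site within sup-distance `h` of
its block centre, weights `w ≥ 0`, `P ≥ 0` with (154) of constant `θ ≥ 0`, `c > 0`, and link kernels with
`‖Ks 0(u,v)‖ ≤ C₀P(u,v)e^{−cd(u,v)}`, `‖Ks (j+1)(u,v)‖ ≤ (C₁∕M_0)P(u,v)e^{−cd(u,v)}`: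
`‖pathKernel w Ks n x y‖ ≤ C₀e^{3c(w′h)}·(C₁θKe^{2c(w′h)}∕M_0)^n·P(x,y)·e^{−(c∕2)d(x,y)}` with
`K = (2∕(1 − e^{−(c∕2)(w′s)∕|ι|}))^{|ι|}`.
[cite: Dimock2004QED3TorusII, §3.2 Thm 1 (134) p.22 L12–19, Remark 3 p.22 L28–30, proof Part III (152)–(155) p.24 L59 – p.25 L12] -/
theorem dimock134_lattice {w θ c : ℝ} {P : X → X → ℝ} {blk : X → B} {ctr : B → X}
    (e : X → (ι → ℤ)) (idx : B → (ι → ℤ)) (hidx : Function.Injective idx) (u₀ : ι → ℤ) {s : ℕ} (hs : 1 ≤ s)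
    (hctr : ∀ b, e (ctr b) = u₀ + s • idx b) {h : ℕ} (hcentre : ∀ u, supDist (e u) (e (ctr (blk u))) ≤ h)
    {w' : ℝ} (hw' : 0 < w') (hw : 0 ≤ w) (hθ : 0 ≤ θ) (hc : 0 < c) (hP0 : ∀ u v, 0 ≤ P u v)
    (hconv : ∀ (b : B) (u v : X),
      ∑ y ∈ univ.filter (fun u => blk u = b), w * (P u y * P y v) ≤ θ * P u v)
    {C₀ C₁ M₀ : ℝ} (hC₀ : 0 ≤ C₀) (hC₁ : 0 ≤ C₁) (hM₀ : 0 < M₀) (Ks : ℕ → X → X → E)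
    (hK0 : ∀ u v, ‖Ks 0 u v‖ ≤ C₀ * (P u v * Real.exp (-(c * pathDist (fun _ => w') (e u) (e v)))))
    (hKS : ∀ j u v, ‖Ks (j + 1) u v‖
      ≤ C₁ / M₀ * (P u v * Real.exp (-(c * pathDist (fun _ => w') (e u) (e v))))) (n : ℕ) (x y : X) :
    ‖pathKernel w Ks n x y‖
      ≤ C₀ * Real.exp (3 * c * (w' * h))
        * (C₁ * θ * (2 / (1 - Real.exp (-(c / 2 * (w' * s) / Fintype.card ι)))) ^ Fintype.card ι
            * Real.exp (2 * c * (w' * h)) / M₀) ^ n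
        * P x y * Real.exp (-(c / 2) * pathDist (fun _ => w') (e x) (e y)) := by
  have hρ : ∀ u : ι → ℤ, (0 : ℝ) ≤ (fun _ : ι → ℤ => w') u := fun _ => hw'.le
  refine dimock134 (d := fun u v => pathDist (fun _ => w') (e u) (e v)) (ctr := ctr) (r := w' * h) hw hθ hc.le hP0
    hconv
    (fun u v => pathDist_nonneg hρ _ _) (fun u v => pathDist_comm hρ _ _)
    (fun u v t => pathDist_triangle hρ _ _ _) (fun u => ?_) (fun b => ?_) hC₀ hC₁ hM₀ Ks hK0 hKS n x y
  · -- `hrad`: every site within `w′·h` of its block centre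
    show pathDist (fun _ => w') (e u) (e (ctr (blk u))) ≤ w' * h
    rw [pathDist_const hw'.le]
    exact mul_le_mul_of_nonneg_left (by exact_mod_cast hcentre u) hw'.le
  · -- `hK`: the single-scale one-point sum (155)
    show ∑ b', Real.exp (-(c / 2) * pathDist (fun _ => w') (e (ctr b)) (e (ctr b')))
        ≤ (2 / (1 - Real.exp (-(c / 2 * (w' * s) / Fintype.card ι)))) ^ Fintype.card ι
    simp_rw [hctr]
    exact one_point_sum_pathDist_const_le idx hidx u₀ hs (half_pos hc) hw' b

end QED3TorusII

end Literature.MathematicalPhysics.QuantumFieldTheory.Dimock2011to13
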